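import Summits.QuantumAdvantage.QuantumAdvantage.Theorems.MobiusLadderLiouvilleOrthogonalTC0StubLtfInfluence
import Summits.QuantumAdvantage.QuantumAdvantage.Theorems.MobiusLadderLiouvilleOrthogonalTC0StubPeresTail
import Summits.QuantumAdvantage.QuantumAdvantage.Theorems.MobiusLadderLiouvilleOrthogonalTC0StubDepthOneLtf
import Summits.QuantumAdvantage.QuantumAdvantage.Theorems.MobiusLadderLiouvilleOrthogonalTC0StubLtfCore
import HarnessLib

/-!
# Crux `MobiusLadder.LiouvilleOrthogonalTC0` (stmt-QuantumAdvantage-1393): the depth-one (threshold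
gate) rung, unconditionally

Line `Sketch`, skeleton v4 (lead `prover-line-stmt-QuantumAdvantage-1393-c2-0`). Assembling the four
landed v4 stubs:

* `tailWeight_ltf_le` — **Peres' theorem** (Y. Peres, *Noise stability of weighted majority*, 2004;
  O'Donnell, *Analysis of Boolean Functions*, §5.5) in Fourier-tail form: for every real-weight linear
  threshold function `f` of `n` Boolean variables and every `m ≥ 1`, `W^{≥ m}[sgn ∘ f] ≤ 3/√m`,
  uniformly in `n` and in the weights (`stub_peresTail` ← `stub_ltfInfluence`);
* `liouville_orthogonal_ltf` — **`λ` is orthogonal to every linear threshold function of the binary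
  digits**: for every `ε > 0`, eventually in `n`, every integer threshold function
  `N ↦ [θ ≤ Σ_i w_i bit_i(N)]` has `|Σ_{N<2ⁿ} λ(N) sgn[…]| ≤ ε 2ⁿ` (`stub_ltfCore`: Bourgain's uniform
  Möbius–Walsh bound for `λ`, Green's §2 deduction, Peres' tail bound);
* `liouville_orthogonal_depthOne` — the same for every circuit over `tcBasis` (`∧ₖ`, `∨ₖ`, `¬`, `MAJₖ`)
  of `acDepth ≤ 1`, with no size restriction (`stub_depthOne_ltf`: such a circuit computes an integer
  threshold function);
* `LiouvilleOrthogonalTC0_depth_le_one` — the crux `LiouvilleOrthogonalTC0` restricted to depths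
  `d ≤ 1`, verbatim in the crux's shape.

This is the `λ`-form, for UNATE gates (negated literals allowed), of the "single majority/threshold
gate" case of Kalai's `TC⁰` conjecture (`Literature.NumberTheory.LFunctions.kalai_moebius_TC0`:
"covered by Bourgain's monotone corollary; depth `≥ 2` is open"). Depth `≥ 2` with a majority gate is
exactly the open residue of the line (`stub_hyp_pos`).
-/

set_option linter.dupNamespace false -- D-0017: single-problem summit ⇒ `QuantumAdvantage.QuantumAdvantage` by design

noncomputable section

namespace Summit.QuantumAdvantage.QuantumAdvantage.Theorems.LiouvilleOrthogonalTC0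

open Filter Finset
open Literature.Computability.Complexity
open Literature.Computability.Complexity.LowDegree (tailWeight)
open Literature.Probability.RandomGraphs.LowDegree (sgn)

/-- **Peres' theorem (Fourier-tail form).** For every real-weight linear threshold function
`f(x) = [θ ≤ Σ_i w_i x_i]` of `n` Boolean variables and every level `m ≥ 1`, the Fourier weight of
`sgn ∘ f` above level `m` is at most `3/√m` — uniformly in `n`, `w`, `θ`. -/
theorem tailWeight_ltf_le (n m : ℕ) (hm : 1 ≤ m) (w : Fin n → ℝ) (θ : ℝ) :
    tailWeight (fun x : Fin n → Bool =>
        sgn (decide (θ ≤ ∑ i, w i * (if x i then (1 : ℝ) else 0)))) m ≤ 3 / Real.sqrt m :=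
  stub_peresTail n m hm w θ (stub_ltfInfluence m)

/-- **`λ` is orthogonal to every linear threshold function of the binary digits** (unconditional):
for every `ε > 0`, for all sufficiently large `n`, every integer threshold function of the `n` low
binary digits has `|Σ_{N<2ⁿ} λ(N) · sgn [θ ≤ Σ_i w_i bit_i(N)]| ≤ ε · 2ⁿ`. -/
theorem liouville_orthogonal_ltf : ∀ ε : ℝ, 0 < ε → ∀ᶠ n : ℕ in atTop, ∀ (w : Fin n → ℤ) (θ : ℤ),
    |∑ N ∈ Finset.range (2 ^ n), ((ArithmeticFunction.liouville N : ℤ) : ℝ) *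
        sgn (decide (θ ≤ ∑ i, w i * (if Nat.testBit N i then (1 : ℤ) else 0)))|
      ≤ ε * (2 : ℝ) ^ n :=
  stub_ltfCore tailWeight_ltf_le

/-- **The depth-one rung of Möbius randomness for `TC⁰`** (unconditional): for every `ε > 0`, for all
sufficiently large `n`, every circuit `C` on the `n` binary digits over `tcBasis` with `acDepth ≤ 1`
(a single `∧/∨/MAJ` gate of literals under free negations — any size) satisfies
`|Σ_{N<2ⁿ} λ(N) · sgn (C(bits N))| ≤ ε · 2ⁿ`. -/
theorem liouville_orthogonal_depthOne : ∀ ε : ℝ, 0 < ε → ∀ᶠ n : ℕ in atTop,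
    ∀ C : Circuit (Fin n), C.IsOver tcBasis → C.acDepth ≤ 1 →
      |∑ N ∈ Finset.range (2 ^ n), ((ArithmeticFunction.liouville N : ℤ) : ℝ) *
          sgn (C.eval (fun i : Fin n => Nat.testBit N i))| ≤ ε * (2 : ℝ) ^ n := by
  intro ε hε
  filter_upwards [liouville_orthogonal_ltf ε hε] with n hn C hB hd
  obtain ⟨w, θ, hC⟩ := stub_depthOne_ltf C hB hd
  simpa only [hC] using hn w θ

/-- **The crux `LiouvilleOrthogonalTC0` at depths `d ≤ 1`, verbatim** (unconditional): for `d ≤ 1`,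
every size polynomial `p` and `ε > 0`, eventually in `n`, every circuit over `tcBasis` with
`acDepth ≤ d` and `size ≤ p(n)` has `|Σ_{N<2ⁿ} λ(N) · sgn (C(bits N))| ≤ ε · 2ⁿ`. -/
theorem LiouvilleOrthogonalTC0_depth_le_one (d : ℕ) (hd : d ≤ 1) :
    ∀ p : Polynomial ℕ, ∀ ε : ℝ, 0 < ε → ∀ᶠ n : ℕ in Filter.atTop,
      ∀ C : Literature.Computability.Complexity.Circuit (Fin n),
        C.IsOver Literature.Computability.Complexity.tcBasis → C.acDepth ≤ d → C.size ≤ p.eval n →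
          |∑ N ∈ Finset.range (2 ^ n), ((ArithmeticFunction.liouville N : ℤ) : ℝ) *
              Literature.Probability.RandomGraphs.LowDegree.sgn
                (C.eval (fun i : Fin n => Nat.testBit N i))| ≤ ε * (2 : ℝ) ^ n := by
  intro p ε hε
  filter_upwards [liouville_orthogonal_depthOne ε hε] with n hn C hB hdC _
  exact hn C hB (hdC.trans hd)

/-- **Registered stub `stub_depthOne`** (line `Sketch`, skeleton v4; glue): the depth-one rung,
verbatim `liouville_orthogonal_depthOne`. -/
theorem stub_depthOne : ∀ ε : ℝ, 0 < ε → ∀ᶠ n : ℕ in atTop, ∀ C : Circuit (Fin n), C.IsOver tcBasis → C.acDepth ≤ 1 → |∑ N ∈ Finset.range (2 ^ n), ((ArithmeticFunction.liouville N : ℤ) : ℝ) * sgn (C.eval (fun i : Fin n => Nat.testBit N i))| ≤ ε * (2 : ℝ) ^ n :=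
  liouville_orthogonal_depthOne

end Summit.QuantumAdvantage.QuantumAdvantage.Theorems.LiouvilleOrthogonalTC0
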